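import Mathlib.LinearAlgebra.Eigenspace.Pi
import Literature.NumberTheory.EllipticCurves.CuspFormTwist
import Literature.NumberTheory.EllipticCurves.ModularityVersionAp
import Literature.NumberTheory.EllipticCurves.NewformsStrongMultiplicityOne
import Literature.NumberTheory.EllipticCurves.NewformsHeckeStableProofs
import Literature.NumberTheory.EllipticCurves.NewformsMultiplicityOneProofs
import Literature.NumberTheory.EllipticCurves.NewformsHeckeProofs
import Literature.NumberTheory.EllipticCurves.NewformsLevelEqOfHeckeEigenvalueEqProofs
import Literature.NumberTheory.EllipticCurves.HeckeOperatorsDoubleCoset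
import Literature.NumberTheory.EllipticCurves.HeckeOperatorsProofs
import HarnessLib

/-!
# Quadratic twists of newforms on `Γ₀(N)`: the twisted eigenvalue packet is the packet of a
# newform, and its level (Atkin–Lehner–Li; Shimura 1971, Prop. 3.64; Atkin–Li 1978, §3)

A proofs-only leaf (theorems only: no definition, no named fact; D-0026), landed by the tenured
seat of `Literature.NumberTheory.Automorphic.BCDT.theoremB` (Breuil–Conrad–Diamond–Taylor 2001,
Thm. B = Thm. 2.2.1) for the step *"up to equivalence and twisting by a quadratic character"* of
the printed proof of Thm. 2.2.1 (JAMS 14 (2001), §2.2, p. 860): the modularity of a mod-`5`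
representation `ρ̄` is to be read off the modularity of a quadratic twist `ρ̄ ⊗ χ`, i.e. — in the
tree's newform wording of "modular" (`ModPGaloisRep.IsModular`) — off **the newform attached to the
twist `f ⊗ ψ` of a newform `f`**.  This file supplies the modular-form side, for newforms on
`Γ₀(N)` and primitive quadratic Dirichlet characters `ψ` (the case of quadratic twists of elliptic
curves), entirely from the tree's (proved) Atkin–Lehner–Li theory:

* `exists_isNewform0_of_eigenpacket` — **the eigenvalue packet of a `T_p`-eigenform (`p ∤ N`) on
  `Γ₀(N)` is the packet of a newform of some level `M ∣ N`** (Atkin–Lehner 1970, Thm. 5 with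
  Thm. 3; Diamond–Shurman Thm. 5.8.3 and its proof): the `Γ₀` twin of the tree's
  `exists_isNewform1_of_eigenpacket` (`NewformsEigenpacketProofs`, for `Γ₁(N)`), with the same
  proof — the Atkin–Lehner family `[α_d]_k g₀` (`g₀` a newform of level `M`, `M d ∣ N`) spans
  `S_k(Γ₀(N))` (`iSup_atkinLehnerComponent_eq_top`, `span_newforms0_holds`), its members are joint
  eigenvectors of the `T_p`, `p ∤ N`, with the packet of `g₀` (`heckeT_degeneracyMap0`,
  `IsNewform0.heckeT_eq_coeff_smul`), and joint generalised eigenspaces of the commuting family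
  `{T_p}` (`heckeT_comm_gamma0_holds`) for distinct packets are independent (Mathlib
  `Module.End.independent_iInf_maxGenEigenspace_of_forall_mapsTo`).
* `heckeT_charTwist_of_isNewform0` — **the twist `f_ψ ∈ S_k(Γ₀(L))` (`N ∣ L`, `m² ∣ L`; the tree's
  `charTwist`, Shimura 1971, Prop. 3.64) of a newform `f ∈ S_k(Γ₀(N))` by a primitive quadratic
  `ψ mod m` is a `T_p`-eigenvector with eigenvalue `ψ(p) a_p(f)` for every prime `p ∤ L`** — compare
  `q`-expansions: `aₙ(T_p f_ψ) = a_{pn}(f_ψ) + p^{k-1} a_{n/p}(f_ψ)` (`qExpansion_coeff_heckeT_holds`,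
  Diamond–Shurman Prop. 5.3.1), `aₙ(f_ψ) = ψ(n) aₙ(f)` (`cuspCoeff_charTwist`) and
  `a_{pn}(f) = a_p(f) aₙ(f) − p^{k−1} a_{n/p}(f)` (`IsNewform0.cuspCoeff_prime_mul`, Prop. 5.8.5),
  with `ψ(p)² = 1`.
* `exists_isNewform0_cuspCoeff_eq_charTwist` — hence **there is a newform `g` of some level
  `M ∣ L` with `a_p(g) = ψ(p) a_p(f)` for every prime `p ∤ L`** (Atkin–Li 1978, §3: the newform
  "`F_ψ`" equivalent to the twist; here only its existence and its packet away from `L`).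
* `level_dvd_mul_sq_of_charTwist_packet` — **level support: `N ∣ M m²`** for any newform `g` of
  level `M` carrying the twisted packet away from a finite set of primes: twisting `g` back by `ψ`
  gives a newform with the packet of `f` away from finitely many primes, which by **strong
  multiplicity one across levels** (`IsNewform0.level_eq_of_heckeEigenvalue_eq_holds`, Atkin–Lehner
  1970, Thm. 4) has level `N`; but its level divides `M m²`.
* `exists_isNewform0_charTwist_packet` — the two combined at `L = N m²`: a newform `g` of level
  `M` with `M ∣ N m²`, `N ∣ M m²` and `a_p(g) = ψ(p) a_p(f)` for all primes `p ∤ N m`.  In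
  particular every prime `p ∤ m` divides `M` iff it divides `N`, and a prime `p ∣ m` with
  `v_p(N) > 2 v_p(m)` divides `M` (`dvd_level_of_charTwist_packet_of_lt`) — the level information
  that replaces, in the BCDT application, the exact level `lcm` formula of Atkin–Li 1978, Thm. 3.1
  (not proved here).

## References

* A. O. L. Atkin, J. Lehner, *Hecke operators on `Γ₀(m)`*, Math. Ann. 185 (1970), 134–160,
  Thms. 3, 4, 5. [AtkinLehner1970]
* A. O. L. Atkin, W.-C. W. Li, *Twists of newforms and pseudo-eigenvalues of `W`-operators*,
  Invent. Math. 48 (1978), 221–243, §3. [AtkinLi1978]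
* G. Shimura, *Introduction to the arithmetic theory of automorphic functions* (1971), Prop. 3.64.
  [Shimura1971]
* F. Diamond, J. Shurman, *A first course in modular forms*, GTM 228 (2005), Prop. 5.3.1,
  Prop. 5.8.5, Thm. 5.8.3. [DiamondShurman2005]
* C. Breuil, B. Conrad, F. Diamond, R. Taylor, *On the modularity of elliptic curves over `ℚ`: wild
  3-adic exercises*, J. Amer. Math. Soc. 14 (2001), §2.2 (proof of Thm. 2.2.1, p. 860). [BCDTJAMS2001]
-/

noncomputable section

open scoped MatrixGroups ModularForm

open CongruenceSubgroup UpperHalfPlane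

namespace Literature.NumberTheory.EllipticCurves.ModularForms

/-! ### The packet of a `T_p`-eigenform on `Γ₀(N)` is a newform packet -/

section Packet

variable {N : ℕ} [NeZero N] {k : ℤ}

/-- **Oldforms from newforms are joint `T_p`-eigenvectors** (`p ∤ N`): for a newform `g₀` of level
`M` and `M d ∣ N`, `T_p ([α_d]_k g₀) = a_p(g₀) [α_d]_k g₀` in `S_k(Γ₀(N))` (Atkin–Lehner 1970, Thm. 3;
Diamond–Shurman Prop. 5.6.2 with Prop. 5.8.5: `heckeT_degeneracyMap0` and
`IsNewform0.heckeT_eq_coeff_smul`). [cite: AtkinLehner1970, Thm. 3] -/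
theorem heckeT_degeneracyMap0_of_isNewform0 {M d : ℕ} [NeZero M] [NeZero d] (hMd : M * d ∣ N)
    {g₀ : CuspForm (Gamma0 M) k} (hg₀ : IsNewform0 g₀) {p : ℕ} (hp : p.Prime) (hpN : ¬ p ∣ N) :
    (haveI : NeZero p := ⟨hp.ne_zero⟩; heckeT (Gamma0 N) k p (degeneracyMap0 M N d k g₀)) =
      cuspCoeff g₀ p • degeneracyMap0 M N d k g₀ := by
  haveI : NeZero p := ⟨hp.ne_zero⟩
  rw [heckeT_degeneracyMap0 hMd hp hpN g₀, hg₀.heckeT_eq_coeff_smul hp, map_smul]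
  rfl

set_option maxHeartbeats 400000 in
/-- **The eigenvalue packet of a `T_p`-eigenform on `Γ₀(N)` is the packet of a newform of level
dividing `N`** (Atkin–Lehner 1970, Thm. 5 with Thm. 3; Diamond–Shurman Thm. 5.8.3 and its proof,
PDF pp. 216–219).  Let `g ∈ S_k(Γ₀(N))`, `g ≠ 0`, with `T_p g = a_p g` for every prime `p ∤ N`.  Then
there are `M ∣ N` and a newform `g₀ ∈ S_k(Γ₀(M))` (`IsNewform0`) with `a_p(g₀) = a_p` for every prime
`p ∤ N`.  Proof as for `Γ₁(N)` (`exists_isNewform1_of_eigenpacket`): the degeneracy images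
`[α_d]_k g₀` of the newforms `g₀` of the levels `M ∣ N` (`M d ∣ N`) span `S_k(Γ₀(N))`
(`iSup_atkinLehnerComponent_eq_top`, `span_newforms0_holds`) and lie in the joint eigenspaces of the
commuting family `{T_p : p ∤ N}` (`heckeT_comm_gamma0_holds`) for the newform packets; these joint
(generalised) eigenspaces are independent for distinct packets (Mathlib
`Module.End.independent_iInf_maxGenEigenspace_of_forall_mapsTo`), and `g` lies in the one of its
own packet, so its packet is a newform packet. [cite: DiamondShurman2005, Thm. 5.8.3 (proof)]
[cite: AtkinLehner1970, Thm. 5] -/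
theorem exists_isNewform0_of_eigenpacket {g : CuspForm (Gamma0 N) k} (hg0 : g ≠ 0) {a : ℕ → ℂ}
    (hT : ∀ (p : ℕ) (hp : p.Prime), ¬ p ∣ N →
      (haveI : NeZero p := ⟨hp.ne_zero⟩; heckeT (Gamma0 N) k p g) = a p • g) :
    ∃ (M : ℕ) (_ : NeZero M) (_ : M ∣ N) (g₀ : CuspForm (Gamma0 M) k), IsNewform0 g₀ ∧
      ∀ p : ℕ, p.Prime → ¬ p ∣ N → cuspCoeff g₀ p = a p := by
  classical
  -- the commuting family `{T_p : p ∤ N}`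
  let I : Type := {p : ℕ // p.Prime ∧ ¬ p ∣ N}
  let F : I → Module.End ℂ (CuspForm (Gamma0 N) k) :=
    fun p ↦ haveI : NeZero p.1 := ⟨p.2.1.ne_zero⟩; heckeT (Gamma0 N) k p.1
  have hcomm : ∀ i j : I, Commute (F i) (F j) := by
    rintro ⟨p, hp, -⟩ ⟨q, hq, -⟩
    haveI : NeZero p := ⟨hp.ne_zero⟩
    haveI : NeZero q := ⟨hq.ne_zero⟩
    exact heckeT_comm_gamma0_holds N k p q
  -- its joint generalised eigenspaces, independent for distinct packets
  let V : (I → ℂ) → Submodule ℂ (CuspForm (Gamma0 N) k) :=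
    fun θ ↦ ⨅ i, (F i).maxGenEigenspace (θ i)
  have hind : iSupIndep V :=
    Module.End.independent_iInf_maxGenEigenspace_of_forall_mapsTo F fun i j φ ↦
      Module.End.mapsTo_maxGenEigenspace_of_comm (hcomm j i) φ
  let pk : (ℕ → ℂ) → I → ℂ := fun a' p ↦ a' p.1
  have hmemV : ∀ {b : CuspForm (Gamma0 N) k} {a' : ℕ → ℂ},
      (∀ (p : ℕ) (hp : p.Prime), ¬ p ∣ N →
        (haveI : NeZero p := ⟨hp.ne_zero⟩; heckeT (Gamma0 N) k p b) = a' p • b) →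
      b ∈ V (pk a') := by
    intro b a' hT'
    change b ∈ ⨅ i, (F i).maxGenEigenspace (pk a' i)
    rw [Submodule.mem_iInf]
    rintro ⟨p, hp, hpN⟩
    exact Module.End.eigenspace_le_maxGenEigenspace
      (Module.End.mem_eigenspace_iff.mpr (hT' p hp hpN))
  have hgV : g ∈ V (pk a) := hmemV hT
  -- the newform packets
  let Θ : Set (I → ℂ) :=
    {θ | ∃ (M : ℕ) (_ : NeZero M) (_ : M ∣ N) (g₀ : CuspForm (Gamma0 M) k),
      IsNewform0 g₀ ∧ θ = pk (cuspCoeff g₀)}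
  -- the Atkin–Lehner family spans, and lies in the joint eigenspaces of the newform packets
  have hspan : (⊤ : Submodule ℂ (CuspForm (Gamma0 N) k)) ≤ ⨆ θ ∈ Θ, V θ := by
    rw [← iSup_atkinLehnerComponent_eq_top k N]
    refine iSup_le fun x ↦ ?_
    rw [atkinLehnerComponent, ← span_newforms0_holds x.1.1 k, Submodule.map_span,
      Submodule.span_le]
    rintro _ ⟨g₀, hg₀, rfl⟩
    have hMN : x.1.1 ∣ N := (dvd_mul_right x.1.1 x.1.2).trans x.2
    have hθ : pk (cuspCoeff g₀) ∈ Θ := ⟨x.1.1, inferInstance, hMN, g₀, hg₀, rfl⟩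
    exact (le_biSup V hθ)
      (hmemV fun p hp hpN ↦ heckeT_degeneracyMap0_of_isNewform0 x.2 hg₀ hp hpN)
  -- hence the packet of `g` is a newform packet
  have hmem : pk a ∈ Θ := by
    by_contra hnot
    have hdis : Disjoint (V (pk a)) (⨆ θ ∈ Θ, V θ) := hind.disjoint_biSup hnot
    exact hg0 ((Submodule.disjoint_def.mp hdis) g hgV (hspan Submodule.mem_top))
  obtain ⟨M, _, hM, g₀, hg₀, hθ⟩ := hmem
  refine ⟨M, inferInstance, hM, g₀, hg₀, fun p hp hpN ↦ ?_⟩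
  have h := congrFun hθ ⟨p, hp, hpN⟩
  exact h.symm

end Packet

/-! ### The twist of a newform is a `T_p`-eigenform away from the level -/

section Twist

variable {N : ℕ} [NeZero N] {k : ℤ} {m : ℕ} [NeZero m] (L : ℕ) [NeZero L]

omit [NeZero N] in
/-- `aₙ(c • f) = c aₙ(f)` on `Γ₀(N)` (Mathlib `ModularForm.qExpansion_smul`). Duplicate of
`cuspCoeff_smul` (`CuspFormLFunctionFrickeProofs`, in the import closure); deprecated restatement
(dedup-01125, 2026-08-16). [folklore] -/
@[deprecated cuspCoeff_smul (since := "2026-08-16")]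
theorem cuspCoeff_const_smul_gamma0 (c : ℂ) (f : CuspForm (Gamma0 N) k) (n : ℕ) :
    cuspCoeff (c • f) n = c * cuspCoeff f n :=
  cuspCoeff_smul c f n

/-- **The quadratic twist of a newform is a `T_p`-eigenvector for `p ∤ L`, with eigenvalue
`ψ(p) a_p(f)`** (the modular-form side of "twisting by a quadratic character"; Shimura 1971,
Prop. 3.64 and Thm. 3.66; Atkin–Li 1978, §3).  For a newform `f ∈ S_k(Γ₀(N))`, a primitive
quadratic Dirichlet character `ψ mod m`, a level `L` with `N ∣ L`, `m² ∣ L`, and a prime `p ∤ L`: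
`T_p f_ψ = ψ(p) a_p(f) f_ψ` in `S_k(Γ₀(L))`, where `f_ψ = charTwist L … f = ∑ ψ(n) aₙ(f) qⁿ`.
Proof by `q`-expansions: `aₙ(T_p f_ψ) = ψ(pn) a_{pn}(f) + p^{k−1} ψ(n/p) a_{n/p}(f)`
(`qExpansion_coeff_heckeT_holds`, `cuspCoeff_charTwist`), and
`a_{pn}(f) = a_p(f) aₙ(f) − p^{k−1} a_{n/p}(f)` (`IsNewform0.cuspCoeff_prime_mul`), with
`ψ(pn) = ψ(p) ψ(n)`, `ψ(n) = ψ(n/p) ψ(p)` when `p ∣ n`, and `ψ(p)² = 1` (`p ∤ m`).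
[cite: Shimura1971, Prop. 3.64] [cite: DiamondShurman2005, Prop. 5.3.1 and Prop. 5.8.5] -/
theorem heckeT_charTwist_of_isNewform0 (hN : N ∣ L) (hm : m ^ 2 ∣ L) {ψ : DirichletCharacter ℂ m}
    (hψ : ψ.IsQuadratic) (hprim : ψ.IsPrimitive) {f : CuspForm (Gamma0 N) k} (hf : IsNewform0 f)
    {p : ℕ} [NeZero p] (hp : p.Prime) (hpL : ¬ p ∣ L) :
    heckeT (Gamma0 L) k p (charTwist L hN hm hψ f) =
      (ψ p * cuspCoeff f p) • charTwist L hN hm hψ f := by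
  have hpN : ¬ p ∣ N := fun h ↦ hpL (h.trans hN)
  have hpm : ¬ p ∣ m := fun h ↦ hpL ((h.trans (dvd_pow_self m two_ne_zero)).trans hm)
  have hunit : IsUnit ((p : ℕ) : ZMod m) := (ZMod.isUnit_prime_iff_not_dvd hp).mpr hpm
  have hsq : ψ p ^ 2 = 1 := apply_sq_eq_one_of_isQuadratic hψ hunit
  refine eq_of_forall_cuspCoeff_eq_gamma0 fun n ↦ ?_
  have hT := qExpansion_coeff_heckeT_holds L k (charTwist L hN hm hψ f) p hp n
  rw [if_neg hpL] at hT
  change cuspCoeff (heckeT (Gamma0 L) k p (charTwist L hN hm hψ f)) n =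
    cuspCoeff (charTwist L hN hm hψ f) (p * n) +
      (p : ℂ) ^ (k - 1) * (if p ∣ n then cuspCoeff (charTwist L hN hm hψ f) (n / p) else 0) at hT
  rw [hT, cuspCoeff_smul, cuspCoeff_charTwist L hN hm hψ hprim f (p * n),
    cuspCoeff_charTwist L hN hm hψ hprim f n, hf.cuspCoeff_prime_mul hp n, if_neg hpN]
  by_cases hpn : p ∣ n
  · rw [if_pos hpn, if_pos hpn, cuspCoeff_charTwist L hN hm hψ hprim f (n / p)]
    obtain ⟨n', rfl⟩ := hpn
    have hdiv : p * n' / p = n' := by rw [Nat.mul_div_cancel_left _ hp.pos]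
    rw [hdiv]
    push_cast
    simp only [map_mul]
    linear_combination (-((p : ℂ) ^ (k - 1) * ψ (n' : ZMod m) * cuspCoeff f n')) * hsq
  · rw [if_neg hpn, if_neg hpn]
    push_cast
    simp only [map_mul]
    ring

/-- **The twisted packet is a newform packet**: for a newform `f ∈ S_k(Γ₀(N))`, a primitive quadratic
`ψ mod m` and `N ∣ L`, `m² ∣ L`, there are `M ∣ L` and a newform `g ∈ S_k(Γ₀(M))` with
`a_p(g) = ψ(p) a_p(f)` for every prime `p ∤ L` (Atkin–Li 1978, §3, the newform equivalent to `f_ψ`;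
here from `exists_isNewform0_of_eigenpacket` applied to the eigenform `f_ψ ≠ 0`,
`heckeT_charTwist_of_isNewform0`, `charTwist_ne_zero`). [cite: AtkinLi1978, §3] -/
theorem exists_isNewform0_cuspCoeff_eq_charTwist (hN : N ∣ L) (hm : m ^ 2 ∣ L)
    {ψ : DirichletCharacter ℂ m} (hψ : ψ.IsQuadratic) (hprim : ψ.IsPrimitive)
    {f : CuspForm (Gamma0 N) k} (hf : IsNewform0 f) :
    ∃ (M : ℕ) (_ : NeZero M) (_ : M ∣ L) (g : CuspForm (Gamma0 M) k), IsNewform0 g ∧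
      ∀ p : ℕ, p.Prime → ¬ p ∣ L → cuspCoeff g p = ψ p * cuspCoeff f p := by
  have h1 : cuspCoeff f 1 ≠ 0 := by
    rw [show cuspCoeff f 1 = 1 from hf.2.2]
    exact one_ne_zero
  exact exists_isNewform0_of_eigenpacket (charTwist_ne_zero L hN hm hψ hprim h1)
    (a := fun p ↦ ψ p * cuspCoeff f p) fun p hp hpL ↦ by
      haveI : NeZero p := ⟨hp.ne_zero⟩
      exact heckeT_charTwist_of_isNewform0 L hN hm hψ hprim hf hp hpL

omit [NeZero L] in
variable {L} in
/-- **Level support of the twisted newform: `N ∣ M m²`.**  Let `f ∈ S_k(Γ₀(N))` be a newform,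
`ψ mod m` primitive quadratic, and `g ∈ S_k(Γ₀(M))` a newform with `a_p(g) = ψ(p) a_p(f)` for all
primes `p` outside a finite set (e.g. `p ∤ L`).  Then `N ∣ M m²`: the twisted packet of `g` is the
packet of a newform `g₁` of some level `M₁ ∣ M m²` (`exists_isNewform0_cuspCoeff_eq_charTwist`), and
`a_p(g₁) = ψ(p)² a_p(f) = a_p(f)` for almost all `p`, so `M₁ = N` by **strong multiplicity one
across levels** (Atkin–Lehner 1970, Thm. 4; `IsNewform0.level_eq_of_heckeEigenvalue_eq_holds`).
[cite: AtkinLehner1970, Thm. 4] [cite: AtkinLi1978, §3] -/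
theorem level_dvd_mul_sq_of_charTwist_packet {ψ : DirichletCharacter ℂ m} (hψ : ψ.IsQuadratic)
    (hprim : ψ.IsPrimitive) {f : CuspForm (Gamma0 N) k} (hf : IsNewform0 f)
    {M : ℕ} [NeZero M] {g : CuspForm (Gamma0 M) k} (hg : IsNewform0 g)
    (hpk : ∀ p : ℕ, p.Prime → ¬ p ∣ L → cuspCoeff g p = ψ p * cuspCoeff f p) (hL : L ≠ 0) :
    N ∣ M * m ^ 2 := by
  haveI : NeZero (M * m ^ 2) := ⟨mul_ne_zero (NeZero.ne M) (pow_ne_zero 2 (NeZero.ne m))⟩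
  obtain ⟨M₁, _, hM₁, g₁, hg₁, hpk₁⟩ := exists_isNewform0_cuspCoeff_eq_charTwist (M * m ^ 2)
    (dvd_mul_right M _) (dvd_mul_left _ M) hψ hprim hg
  -- `g₁` and `f` have the same Hecke eigenvalues at the primes `p ∤ L M m²`
  have hfin : {p : ℕ | p.Prime ∧ heckeEigenvalue g₁ p ≠ heckeEigenvalue f p}.Finite := by
    refine (L * (M * m ^ 2)).primeFactors.finite_toSet.subset ?_
    rintro p ⟨hp, hne⟩
    rw [Finset.mem_coe, Nat.mem_primeFactors]
    refine ⟨hp, ?_, mul_ne_zero hL (NeZero.ne _)⟩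
    by_contra hndvd
    have hpL : ¬ p ∣ L := fun h ↦ hndvd (dvd_mul_of_dvd_left h _)
    have hpMm : ¬ p ∣ M * m ^ 2 := fun h ↦ hndvd (dvd_mul_of_dvd_right h _)
    have hpm : ¬ p ∣ m := fun h ↦ hpMm (dvd_mul_of_dvd_right (h.trans (dvd_pow_self m two_ne_zero)) _)
    have hunit : IsUnit ((p : ℕ) : ZMod m) := (ZMod.isUnit_prime_iff_not_dvd hp).mpr hpm
    have hsq : ψ p ^ 2 = 1 := apply_sq_eq_one_of_isQuadratic hψ hunit
    apply hne
    rw [heckeEigenvalue_eq_coeff_of_isNormalized hg₁.2.2 hp (hg₁.2.1 p hp),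
      heckeEigenvalue_eq_coeff_of_isNormalized hf.2.2 hp (hf.2.1 p hp)]
    change cuspCoeff g₁ p = cuspCoeff f p
    rw [hpk₁ p hp hpMm, hpk p hp hpL]
    linear_combination cuspCoeff f p * hsq
  have hN₁ : M₁ = N := IsNewform0.level_eq_of_heckeEigenvalue_eq_holds hg₁ hf hfin
  rw [← hN₁]
  exact hM₁

/-- **The twisted newform and its level** (the two previous results at `L = N m²`): for a newform
`f ∈ S_k(Γ₀(N))` and a primitive quadratic `ψ mod m` there are a level `M` with `M ∣ N m²` and
`N ∣ M m²` and a newform `g ∈ S_k(Γ₀(M))` with `a_p(g) = ψ(p) a_p(f)` for every prime `p ∤ N m²`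
(Atkin–Li 1978, §3; the exact level of op. cit. Thm. 3.1 is not needed downstream and not proved).
[cite: AtkinLi1978, §3] -/
theorem exists_isNewform0_charTwist_packet {ψ : DirichletCharacter ℂ m} (hψ : ψ.IsQuadratic)
    (hprim : ψ.IsPrimitive) {f : CuspForm (Gamma0 N) k} (hf : IsNewform0 f) :
    ∃ (M : ℕ) (_ : NeZero M) (_ : M ∣ N * m ^ 2) (_ : N ∣ M * m ^ 2) (g : CuspForm (Gamma0 M) k),
      IsNewform0 g ∧ ∀ p : ℕ, p.Prime → ¬ p ∣ N * m ^ 2 → cuspCoeff g p = ψ p * cuspCoeff f p := by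
  haveI : NeZero (N * m ^ 2) := ⟨mul_ne_zero (NeZero.ne N) (pow_ne_zero 2 (NeZero.ne m))⟩
  obtain ⟨M, _, hM, g, hg, hpk⟩ := exists_isNewform0_cuspCoeff_eq_charTwist (N * m ^ 2)
    (dvd_mul_right N _) (dvd_mul_left _ N) hψ hprim hf
  exact ⟨M, inferInstance, hM, level_dvd_mul_sq_of_charTwist_packet hψ hprim hf hg hpk (NeZero.ne _),
    g, hg, hpk⟩

omit [NeZero N] in
/-- **Primes of the twisted level.**  If `N ∣ M m²` (`M, m ≠ 0`) then every `p` with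
`2 v_p(m) < v_p(N)` (necessarily a prime) divides `M` (compare `p`-adic valuations). [folklore] -/
theorem dvd_level_of_charTwist_packet_of_lt {M : ℕ} (hM0 : M ≠ 0) (hNM : N ∣ M * m ^ 2)
    {p : ℕ} (hlt : 2 * m.factorization p < N.factorization p) : p ∣ M := by
  by_contra hpM
  have hm0 : m ≠ 0 := NeZero.ne m
  have h1 : N.factorization p ≤ (M * m ^ 2).factorization p :=
    (Nat.factorization_le_iff_dvd (fun h ↦ by simp [h] at hlt) (mul_ne_zero hM0 (pow_ne_zero 2 hm0))).mpr
      hNM p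
  rw [Nat.factorization_mul hM0 (pow_ne_zero 2 hm0), Finsupp.add_apply, Nat.factorization_pow,
    Finsupp.smul_apply, smul_eq_mul, Nat.factorization_eq_zero_of_not_dvd hpM, zero_add] at h1
  omega

omit [NeZero N] [NeZero m] in
/-- If `M ∣ N m²` and `N ∣ M m²`, a prime not dividing `m` divides `M` iff it divides `N`. [folklore] -/
theorem dvd_level_iff_of_charTwist_packet {M : ℕ} (hMN : M ∣ N * m ^ 2) (hNM : N ∣ M * m ^ 2)
    {p : ℕ} (hp : p.Prime) (hpm : ¬ p ∣ m) : p ∣ M ↔ p ∣ N := by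
  have hpm2 : ¬ p ∣ m ^ 2 := fun h ↦ hpm (hp.dvd_of_dvd_pow h)
  constructor
  · intro h
    rcases hp.dvd_mul.mp (h.trans hMN) with h' | h'
    · exact h'
    · exact (hpm2 h').elim
  · intro h
    rcases hp.dvd_mul.mp (h.trans hNM) with h' | h'
    · exact h'
    · exact (hpm2 h').elim

end Twist

end Literature.NumberTheory.EllipticCurves.ModularForms

end
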